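import Summits.QuantumFields.YangMills.Theorems.LuscherReductionTwistedTraceScalingFPWeightRelative
import HarnessLib

/-!
# The Faddeev–Popov weight at a slice point WITHOUT the support-radius loss `e^{−6nR₁²}`: a sharp lower Laplace bound and the relative sandwich with errors
# `O(η + s²) + O(e^{−c²r²/4s²}) + O(‖p‖²)` only — the first brick of F9 ((N) POINTWISE AT RATE) for the rate twin
# (route `FlatTubeReduction`, crux K1 `NearFlatRatioLaw` stmt-QuantumFields-24720; seat `ym-line-ftr-p1` g14; rate twin «ratepack-v3 / frozen fibres»; R2b1 RECORD rung — no summit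
# statement is proved here; re-uses RED lane A's (N2) tool-chain `…FPWeightLaplace` / `…FPWeightRelative` for crux 20203 verbatim)

WHY (memo `Cruxes/NearFlatRatioLaw/Lines/ratepack-v3-frozen-g12.md` §8).  Lane A's `fpWeight_laplace_bounds` bounds the gnomonic Haar density below by its minimum `e^{−6nR₁²}` over the
whole support radius `R₁ = O(ρ)` of the indicator, which costs a relative `O(ρ²) = O(β^{-1/3})` in the LOWER bound — harmless at first order (`(P)`: relative `O(δ²)` uniformly), fatal for the
POINTWISE ratio `N(oT u v)/N(oT 1 v) = 1 + κ_N·orbitDist u² + O(λ_b²)` that the normalised dressing needs.  FIX: absorb the density's Gaussian factor `e^{−2Σw²}` into the Laplace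
exponent instead: on the core, by coercivity `c‖w‖ ≤ ‖Aw‖`, `2Σ_{i,a}w_{ia}² ≤ 6n‖w‖² ≤ (6n/c²)‖Aw‖²`, so `e^{−2Σw²}·e^{−(1+η)‖Aw‖²/s²} ≥ e^{−(1+η′)‖Aw‖²/s²}` with `η′ = η + 6ns²/c²` —
an extra RELATIVE `O(s²) = O(β^{-2})` — and `laplace_sandwich` applies to `e^{−2Σw²}·G`.
* ★★ `fpWeight_laplace_lower_sharp` — `(2π²)^{-n}·(I(1+η′) − e^{−c²r²/2s²}I(½)) ≤ N(tubePt p)`;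
* ★★★ `fpWeight_relative_bounds_sharp` — `N̄(s)(1 − (d/2)η′ − 2^{d/2}e^{−c²r²/2s²})(1 − x) ≤ N(tubePt p) ≤ N̄(s)(1 + 4(d/2)η + 4^{d/2}e^{−c²r²/4s²})(1 + x)`, `|gramDet p/gramDet 0 − 1| ≤ x`
  (`≤ K‖p‖²` by `exists_gramDet_ratio_bound`): every error is `O(r) + O(s²) + O(e^{−c²r²/4s²}) + O(‖p‖²)` — no `R₁`.
HONEST FRAMING: a sharpening of lane A's (N2) lower bound, bookkeeping on their landed tool-chain; (N)-pointwise itself (the ratio at `oT u v` vs `oT 1 v`, F9c–e) remains; femto rung R2b1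
(RECORD label); not infinite volume, not a gap, not Clay.  No defs, no named facts, no `sorry`.
-/

set_option autoImplicit false

noncomputable section

open MeasureTheory Real Module
open scoped BigOperators
open Literature.MathematicalPhysics.QuantumFieldTheory
open Literature.MathematicalPhysics.QuantumLattice

namespace Summit.QuantumFields.YangMills.Theorems.FemtoTransferGap.TwoLattice.ConstTube

open Summit.QuantumFields.YangMills.Theorems.FemtoTransferGap
open Summit.QuantumFields.YangMills.Theorems.FemtoTransferGap.TwoLattice.Avg
open Summit.QuantumFields.YangMills.Theorems.FemtoTransferGap.TwoLattice.Stiff (LinkSpace)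
open Summit.QuantumFields.YangMills.Theorems.FemtoTransferGap.TwoLattice.GnChart

variable (L : ℕ) [NeZero L]

set_option maxHeartbeats 800000 in
/-- ★★ **SHARP LOWER LAPLACE BOUND** (data as in `fpWeight_laplace_bounds`; `η′ = η + 6n·s²/c² < 1`):
`(2π²)^{-n}·(I(1+η′) − e^{−c²r²/(2s²)}·I(1/2)) ≤ N(tubePt p)` — no support-radius factor. [cite: Luscher1983, §3] -/
theorem fpWeight_laplace_lower_sharp (hL : Nonempty (NzSite L)) {δ ρ δg : ℝ → ℝ} {β : ℝ} (hs : 0 < δg β)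
    (p : balancedSubmodule L × (Fin 3 → Fin 3 → ℝ))
    {εT M : ℝ} (hM0 : 0 ≤ M) (hεT : 0 < εT)
    (hT : ∀ (ξ : basedSubmodule L) (q : balancedSubmodule L × (Fin 3 → Fin 3 → ℝ)), ‖ξ‖ < εT → ‖q‖ < εT →
      ‖basedFn L (ξ, q) - basedFn L (0, q) - basedLin L q ξ‖ ≤ M * ‖ξ‖ ^ 2)
    {εC : ℝ} (hC : ∀ q : balancedSubmodule L × (Fin 3 → Fin 3 → ℝ), ‖q‖ < εC →
      ∀ ξ : basedSubmodule L, ‖ξ‖ ≤ 4 * sliceConst L * ‖(gaugeModes L).starProjection (basedLin L q ξ)‖)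
    (hpT : ‖p‖ < εT) (hpC : ‖p‖ < εC) (hp40 : ‖p‖ ≤ 1 / 40)
    (hslice : (gaugeModes L).starProjection (linkEmbed L (p.1 : Edge 3 L → Fin 3 → ℝ)) = 0)
    {ρ₁ : ℝ} (hU : tubePt L p ∈ fatTubeRho L δ (fun _ => ρ₁) β)
    {r R₁ : ℝ} (hr0 : 0 ≤ r) (hrR : r ≤ R₁) (hR1 : R₁ ≤ 1 / 2) (hR1T : R₁ < εT) (hcore : ρ₁ + 8 * r ≤ ρ β)
    (hsupp : 3 * ((L : ℝ) - 1) * (ρ₁ + ρ β) ≤ R₁)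
    (hθ : (M + 2 * ‖basedLin L p‖) * R₁ * (4 * sliceConst L) ≤ 1 / 4)
    (hη' : 3 * ((M + 2 * ‖basedLin L p‖) * r * (4 * sliceConst L)) + 6 * Fintype.card (NzSite L) * δg β ^ 2 / (1 / (4 * sliceConst L)) ^ 2 < 1) :
    ((2 * π ^ 2)⁻¹) ^ Fintype.card (NzSite L) *
        ((∫ w, Real.exp (-((1 + (3 * ((M + 2 * ‖basedLin L p‖) * r * (4 * sliceConst L)) + 6 * Fintype.card (NzSite L) * δg β ^ 2 / (1 / (4 * sliceConst L)) ^ 2)) *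
            ‖laplaceMap L p w‖ ^ 2 / δg β ^ 2))) -
          Real.exp (-((1 / (4 * sliceConst L)) ^ 2 * r ^ 2 / (2 * δg β ^ 2))) * ∫ w, Real.exp (-(1 / 2 * ‖laplaceMap L p w‖ ^ 2 / δg β ^ 2))) ≤
      gaugeAvg (recordWeightRho L δ ρ δg β) (tubePt L p) := by
  classical
  haveI := hL
  set n : ℕ := Fintype.card (NzSite L) with hn
  set s : ℝ := δg β with hsdef
  set c : ℝ := 1 / (4 * sliceConst L) with hcdef
  set η : ℝ := 3 * ((M + 2 * ‖basedLin L p‖) * r * (4 * sliceConst L)) with hη_def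
  set η' : ℝ := η + 6 * n * s ^ 2 / c ^ 2 with hη'_def
  have hCpos := sliceConst_pos L
  have hM'0 : 0 ≤ (M + 2 * ‖basedLin L p‖) := by positivity
  have hc0 : 0 < c := by rw [hcdef]; positivity
  have hU1 : tubePt L p ∈ nearOne L ρ₁ := hU.1
  obtain ⟨hcoer, hcoreB, hoffB, -⟩ := fpIntegrand_envelope_hyps L hL hs p hM0 hεT hT hC hpT hpC hp40 hslice hU hr0 hrR hR1 hR1T hcore hsupp hθ
  have hG0 : ∀ w, 0 ≤ fpIntegrand L δ ρ δg β p w := fun w => (fpIntegrand_mem_Icc L δ ρ δg β p w).1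
  have hη0 : 0 ≤ η := by rw [hη_def]; positivity
  have hη'0 : 0 ≤ η' := by rw [hη'_def]; positivity
  have hηη' : η ≤ η' := by
    rw [hη'_def]
    have : 0 ≤ 6 * (n : ℝ) * s ^ 2 / c ^ 2 := by positivity
    linarith
  have hη'1 : η' < 1 := hη'
  -- the Gaussian-weighted integrand `G″ = e^{−2Σw²}·G`
  set G'' : (NzSite L → Fin 3 → ℝ) → ℝ := fun w => Real.exp (-(2 * ∑ i, ∑ a, w i a ^ 2)) * fpIntegrand L δ ρ δg β p w with hG''
  have hSm : Measurable fun w : NzSite L → Fin 3 → ℝ => ∑ i, ∑ a, w i a ^ 2 :=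
    Finset.measurable_sum _ fun i _ => Finset.measurable_sum _ fun a _ => ((measurable_pi_apply a).comp (measurable_pi_apply i)).pow_const 2
  have hG''m : Measurable G'' := (Real.measurable_exp.comp (hSm.const_mul 2).neg).mul (measurable_fpIntegrand L δ ρ δg β p)
  have hG''0 : ∀ w, 0 ≤ G'' w := fun w => mul_nonneg (Real.exp_pos _).le (hG0 w)
  have hG''le : ∀ w, G'' w ≤ fpIntegrand L δ ρ δg β p w := fun w => by
    have h1 : Real.exp (-(2 * ∑ i, ∑ a, w i a ^ 2)) ≤ 1 := Real.exp_le_one_iff.mpr (by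
      have : 0 ≤ ∑ i, ∑ a, w i a ^ 2 := Finset.sum_nonneg fun i _ => Finset.sum_nonneg fun a _ => sq_nonneg _
      linarith)
    calc G'' w = Real.exp (-(2 * ∑ i, ∑ a, w i a ^ 2)) * fpIntegrand L δ ρ δg β p w := rfl
      _ ≤ 1 * fpIntegrand L δ ρ δg β p w := mul_le_mul_of_nonneg_right h1 (hG0 w)
      _ = _ := one_mul _
  -- envelope hypotheses for `G″` at `η′`
  have hcore'' : ∀ w : NzSite L → Fin 3 → ℝ, ‖w‖ ≤ r →
      Real.exp (-((1 + η') * ‖laplaceMap L p w‖ ^ 2 / s ^ 2)) ≤ G'' w ∧ G'' w ≤ Real.exp (-((1 - η') * ‖laplaceMap L p w‖ ^ 2 / s ^ 2)) := by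
    intro w hw
    obtain ⟨hlo, hhi⟩ := hcoreB w hw
    have hQ0 : 0 ≤ ‖laplaceMap L p w‖ ^ 2 := sq_nonneg _
    refine ⟨?_, (hG''le w).trans (hhi.trans (Real.exp_le_exp.mpr ?_))⟩
    · -- `2Σw² ≤ 6n‖w‖² ≤ (6n/c²)‖Aw‖²`
      have hS : ∑ i, ∑ a, w i a ^ 2 ≤ 3 * n * ‖w‖ ^ 2 := sum_sum_sq_le w
      have hw2 : c ^ 2 * ‖w‖ ^ 2 ≤ ‖laplaceMap L p w‖ ^ 2 := by
        have h := hcoer w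
        have h0 : 0 ≤ c * ‖w‖ := by positivity
        calc c ^ 2 * ‖w‖ ^ 2 = (c * ‖w‖) ^ 2 := by ring
          _ ≤ ‖laplaceMap L p w‖ ^ 2 := pow_le_pow_left₀ h0 h 2
      have hkey : 2 * ∑ i, ∑ a, w i a ^ 2 ≤ 6 * n * s ^ 2 / c ^ 2 * ‖laplaceMap L p w‖ ^ 2 / s ^ 2 := by
        have e : 6 * (n : ℝ) * s ^ 2 / c ^ 2 * ‖laplaceMap L p w‖ ^ 2 / s ^ 2 = 6 * n * (‖laplaceMap L p w‖ ^ 2 / c ^ 2) := by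
          field_simp
        rw [e]
        have : ‖w‖ ^ 2 ≤ ‖laplaceMap L p w‖ ^ 2 / c ^ 2 := by rw [le_div_iff₀ (by positivity)]; linarith
        nlinarith [this, show (0 : ℝ) ≤ 6 * n by positivity]
      calc Real.exp (-((1 + η') * ‖laplaceMap L p w‖ ^ 2 / s ^ 2))
          ≤ Real.exp (-(2 * ∑ i, ∑ a, w i a ^ 2)) * Real.exp (-((1 + η) * ‖laplaceMap L p w‖ ^ 2 / s ^ 2)) := by
            rw [← Real.exp_add, Real.exp_le_exp, hη'_def]
            have e : (1 + (η + 6 * ↑n * s ^ 2 / c ^ 2)) * ‖laplaceMap L p w‖ ^ 2 / s ^ 2 =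
                (1 + η) * ‖laplaceMap L p w‖ ^ 2 / s ^ 2 + 6 * ↑n * s ^ 2 / c ^ 2 * ‖laplaceMap L p w‖ ^ 2 / s ^ 2 := by ring
            rw [e]; linarith
        _ ≤ G'' w := mul_le_mul_of_nonneg_left hlo (Real.exp_pos _).le
    · have := mul_le_mul_of_nonneg_right hηη' hQ0
      rw [neg_le_neg_iff, div_le_div_iff_of_pos_right (by positivity)]
      nlinarith
  have hoff'' : ∀ w : NzSite L → Fin 3 → ℝ, r < ‖w‖ → G'' w ≤ Real.exp (-(‖laplaceMap L p w‖ ^ 2 / (2 * s ^ 2))) := fun w hw => (hG''le w).trans (hoffB w hw)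
  obtain ⟨hlow, -⟩ := laplace_sandwich (laplaceMap L p) (c := c) (s := s) (r := r) (η := η') (G := G'') hc0 hs hr0 hη'0 hη'1 hcoer hG''m hG''0 hcore'' hoff''
  -- integrability of `dens·G` (as in lane A's proof)
  have hη1 : η < 1 := lt_of_le_of_lt hηη' hη'1
  have hI : ∀ a : ℝ, 0 < a → Integrable (fun w : NzSite L → Fin 3 → ℝ => Real.exp (-(a * ‖laplaceMap L p w‖ ^ 2 / s ^ 2))) := fun a ha =>
    integrable_exp_neg_quad (laplaceMap L p) hc0 hs ha hcoer
  have hGint : Integrable (fpIntegrand L δ ρ δg β p) := by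
    have hup := laplace_upper_envelope (laplaceMap L p) (c := c) (s := s) (r := r) (η := η) (G := fpIntegrand L δ ρ δg β p) hc0 hr0 hcoer hcoreB hoffB
    have hUi : Integrable (fun w : NzSite L → Fin 3 → ℝ => Real.exp (-((1 - η) * ‖laplaceMap L p w‖ ^ 2 / s ^ 2)) +
        Real.exp (-(c ^ 2 * r ^ 2 / (4 * s ^ 2))) * Real.exp (-(1 / 4 * ‖laplaceMap L p w‖ ^ 2 / s ^ 2))) :=
      (hI (1 - η) (sub_pos.mpr hη1)).add ((hI (1 / 4) (by norm_num)).const_mul (Real.exp (-(c ^ 2 * r ^ 2 / (4 * s ^ 2)))))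
    have hbound : ∀ w : NzSite L → Fin 3 → ℝ, ‖fpIntegrand L δ ρ δg β p w‖ ≤ Real.exp (-((1 - η) * ‖laplaceMap L p w‖ ^ 2 / s ^ 2)) +
        Real.exp (-(c ^ 2 * r ^ 2 / (4 * s ^ 2))) * Real.exp (-(1 / 4 * ‖laplaceMap L p w‖ ^ 2 / s ^ 2)) := fun w => by
      have h1 : ‖fpIntegrand L δ ρ δg β p w‖ = fpIntegrand L δ ρ δg β p w := Real.norm_of_nonneg (hG0 w)
      exact h1.le.trans (hup w)
    exact hUi.mono' (measurable_fpIntegrand L δ ρ δg β p).aestronglyMeasurable (ae_of_all _ hbound)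
  have hG''int : Integrable G'' := hGint.mono' hG''m.aestronglyMeasurable (ae_of_all _ fun w => by
    rw [Real.norm_eq_abs, abs_of_nonneg (hG''0 w)]; exact hG''le w)
  have hN : gaugeAvg (recordWeightRho L δ ρ δg β) (tubePt L p) = ∫ w, piGnDensityReal (NzSite L) w * fpIntegrand L δ ρ δg β p w :=
    gaugeAvg_eq_integral_fpIntegrand L p hU1 (lt_of_le_of_lt hsupp (by linarith only [hR1]))
  have hb2 : ∀ w : NzSite L → Fin 3 → ℝ, ‖piGnDensityReal (NzSite L) w * fpIntegrand L δ ρ δg β p w‖ ≤ ((2 * π ^ 2)⁻¹) ^ n * fpIntegrand L δ ρ δg β p w :=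
    fun w => by
      obtain ⟨hd0, hd1⟩ := piGnDensityReal_pos_le (NzSite L) w
      have e : ‖piGnDensityReal (NzSite L) w * fpIntegrand L δ ρ δg β p w‖ = piGnDensityReal (NzSite L) w * fpIntegrand L δ ρ δg β p w :=
        Real.norm_of_nonneg (mul_nonneg hd0.le (hG0 w))
      exact e.le.trans (mul_le_mul_of_nonneg_right hd1 (hG0 w))
  have hdens_int : Integrable fun w : NzSite L → Fin 3 → ℝ => piGnDensityReal (NzSite L) w * fpIntegrand L δ ρ δg β p w :=
    (hGint.const_mul (((2 * π ^ 2)⁻¹) ^ n)).mono' ((measurable_piGnDensityReal (NzSite L)).mul (measurable_fpIntegrand L δ ρ δg β p)).aestronglyMeasurable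
      (ae_of_all _ hb2)
  -- pointwise: `dens·G ≥ (2π²)^{-n}·G″`
  have hpt : ∀ w, ((2 * π ^ 2)⁻¹) ^ n * G'' w ≤ piGnDensityReal (NzSite L) w * fpIntegrand L δ ρ δg β p w := fun w => by
    have h1 := piGnDensityReal_ge_exp (NzSite L) w
    calc ((2 * π ^ 2)⁻¹) ^ n * G'' w = ((2 * π ^ 2)⁻¹) ^ n * Real.exp (-(2 * ∑ i, ∑ a, w i a ^ 2)) * fpIntegrand L δ ρ δg β p w := by rw [hG'']; ring
      _ ≤ piGnDensityReal (NzSite L) w * fpIntegrand L δ ρ δg β p w := mul_le_mul_of_nonneg_right h1 (hG0 w)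
  have hmono := integral_mono (hG''int.const_mul _) hdens_int hpt
  rw [integral_const_mul] at hmono
  rw [hN]
  exact le_trans (mul_le_mul_of_nonneg_left hlow (by positivity)) hmono

set_option maxHeartbeats 800000 in
/-- ★★★ **THE RELATIVE SANDWICH WITHOUT THE SUPPORT-RADIUS LOSS** (data as in `fpWeight_relative_bounds`, with `η′ = η + 6n·s²/c²` in place of the `(1 − 6nR₁²)` factor):
`N̄(s)(1 − (d/2)η′ − 2^{d/2}e^{−c²r²/(2s²)})(1 − x) ≤ N(tubePt p) ≤ N̄(s)(1 + 4(d/2)η + 4^{d/2}e^{−c²r²/(4s²)})(1 + x)`. [cite: Luscher1983, §3] -/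
theorem fpWeight_relative_bounds_sharp (hL : Nonempty (NzSite L)) {δ ρ δg : ℝ → ℝ} {β : ℝ} (hs : 0 < δg β)
    (p : balancedSubmodule L × (Fin 3 → Fin 3 → ℝ))
    (hpI : ∀ {a s : ℝ}, 0 < a → 0 < s →
      ∫ w, Real.exp (-(a * ‖laplaceMap L p w‖ ^ 2 / s ^ 2)) ∂(volume : Measure (NzSite L → Fin 3 → ℝ)) =
        (π * s ^ 2 / a) ^ (finrank ℝ (EuclideanSpace ℝ (NzSite L × Fin 3)) / 2 : ℝ) / Real.sqrt (gramDet L p))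
    {εT M : ℝ} (hM0 : 0 ≤ M) (hεT : 0 < εT)
    (hT : ∀ (ξ : basedSubmodule L) (q : balancedSubmodule L × (Fin 3 → Fin 3 → ℝ)), ‖ξ‖ < εT → ‖q‖ < εT →
      ‖basedFn L (ξ, q) - basedFn L (0, q) - basedLin L q ξ‖ ≤ M * ‖ξ‖ ^ 2)
    {εC : ℝ} (hC : ∀ q : balancedSubmodule L × (Fin 3 → Fin 3 → ℝ), ‖q‖ < εC →
      ∀ ξ : basedSubmodule L, ‖ξ‖ ≤ 4 * sliceConst L * ‖(gaugeModes L).starProjection (basedLin L q ξ)‖)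
    (hpT : ‖p‖ < εT) (hpC : ‖p‖ < εC) (hp40 : ‖p‖ ≤ 1 / 40)
    (hslice : (gaugeModes L).starProjection (linkEmbed L (p.1 : Edge 3 L → Fin 3 → ℝ)) = 0)
    {ρ₁ : ℝ} (hU : tubePt L p ∈ fatTubeRho L δ (fun _ => ρ₁) β)
    {r R₁ : ℝ} (hr0 : 0 ≤ r) (hrR : r ≤ R₁) (hR1 : R₁ ≤ 1 / 2) (hR1T : R₁ < εT) (hcore : ρ₁ + 8 * r ≤ ρ β)
    (hsupp : 3 * ((L : ℝ) - 1) * (ρ₁ + ρ β) ≤ R₁)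
    (hθ : (M + 2 * ‖basedLin L p‖) * R₁ * (4 * sliceConst L) ≤ 1 / 4)
    (hη2 : fpEta L M p r ≤ 1 / 2)
    (hη'd : (flatDim L / 2 : ℝ) * (fpEta L M p r + 6 * Fintype.card (NzSite L) * δg β ^ 2 / (1 / (4 * sliceConst L)) ^ 2) ≤ 1 / 4)
    (hη'1 : fpEta L M p r + 6 * Fintype.card (NzSite L) * δg β ^ 2 / (1 / (4 * sliceConst L)) ^ 2 < 1)
    (htail : (2 : ℝ) ^ (flatDim L / 2 : ℝ) * Real.exp (-((1 / (4 * sliceConst L)) ^ 2 * r ^ 2 / (2 * δg β ^ 2))) ≤ 1 / 4)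
    {x : ℝ} (hx : |gramDet L p / gramDet L 0 - 1| ≤ x) (hx2 : x ≤ 1 / 2) :
    fpWeightBar L (δg β) * ((1 - 0) *
        ((1 - (flatDim L / 2 : ℝ) * (fpEta L M p r + 6 * Fintype.card (NzSite L) * δg β ^ 2 / (1 / (4 * sliceConst L)) ^ 2) -
            (2 : ℝ) ^ (flatDim L / 2 : ℝ) * Real.exp (-((1 / (4 * sliceConst L)) ^ 2 * r ^ 2 / (2 * δg β ^ 2)))) * (1 - x))) ≤
        gaugeAvg (recordWeightRho L δ ρ δg β) (tubePt L p) ∧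
      gaugeAvg (recordWeightRho L δ ρ δg β) (tubePt L p) ≤ fpWeightBar L (δg β) *
        ((1 + 4 * (flatDim L / 2 : ℝ) * fpEta L M p r + (4 : ℝ) ^ (flatDim L / 2 : ℝ) * Real.exp (-((1 / (4 * sliceConst L)) ^ 2 * r ^ 2 / (4 * δg β ^ 2)))) *
          (1 + x)) := by
  have hCpos := sliceConst_pos L
  have hη0 : 0 ≤ fpEta L M p r := fpEta_nonneg L hM0 p hr0
  have he0 : (0 : ℝ) ≤ (flatDim L / 2 : ℝ) := by positivity
  have hX0 : 0 ≤ π * δg β ^ 2 := by positivity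
  have hA0 : 0 < ((2 * π ^ 2)⁻¹ : ℝ) ^ Fintype.card (NzSite L) := by positivity
  have hG0 := gramDet_zero_pos L
  have hη'0 : 0 ≤ fpEta L M p r + 6 * Fintype.card (NzSite L) * δg β ^ 2 / (1 / (4 * sliceConst L)) ^ 2 := by positivity
  have hηd : (flatDim L / 2 : ℝ) * fpEta L M p r ≤ 1 / 4 := by
    have : (flatDim L / 2 : ℝ) * fpEta L M p r ≤ (flatDim L / 2 : ℝ) * (fpEta L M p r + 6 * Fintype.card (NzSite L) * δg β ^ 2 / (1 / (4 * sliceConst L)) ^ 2) :=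
      mul_le_mul_of_nonneg_left (by
        have : 0 ≤ 6 * (Fintype.card (NzSite L) : ℝ) * δg β ^ 2 / (1 / (4 * sliceConst L)) ^ 2 := by positivity
        linarith) he0
    exact this.trans hη'd
  refine ⟨?_, ?_⟩
  · -- lower: the sharp Laplace bound in the shape of `fpWeight_lower_algebra` with `Rsq = 0`
    have hlo := fpWeight_laplace_lower_sharp L hL hs p hM0 hεT hT hC hpT hpC hp40 hslice hU hr0 hrR hR1 hR1T hcore hsupp hθ (by unfold fpEta at hη'1; exact hη'1)
    have hη1' : 0 < 1 + (fpEta L M p r + 6 * Fintype.card (NzSite L) * δg β ^ 2 / (1 / (4 * sliceConst L)) ^ 2) := by linarith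
    have e1 := hpI hη1' hs
    have e2 := hpI (show (0 : ℝ) < 1 / 2 by norm_num) hs
    unfold fpEta at e1
    rw [e1, e2] at hlo
    have hlo' : ((2 * π ^ 2)⁻¹) ^ Fintype.card (NzSite L) * Real.exp (-(0 : ℝ)) *
        ((π * δg β ^ 2 / (1 + (fpEta L M p r + 6 * Fintype.card (NzSite L) * δg β ^ 2 / (1 / (4 * sliceConst L)) ^ 2))) ^ (flatDim L / 2 : ℝ) / Real.sqrt (gramDet L p) -
          Real.exp (-((1 / (4 * sliceConst L)) ^ 2 * r ^ 2 / (2 * δg β ^ 2))) * ((π * δg β ^ 2 / (1 / 2)) ^ (flatDim L / 2 : ℝ) / Real.sqrt (gramDet L p))) ≤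
        gaugeAvg (recordWeightRho L δ ρ δg β) (tubePt L p) := by
      rw [neg_zero, Real.exp_zero, mul_one]
      unfold fpEta
      simpa only [flatDim] using hlo
    exact fpWeight_lower_algebra hA0 hX0 he0 hη'0 hη'd htail (le_of_lt one_pos) hG0 hx hx2 hlo'
  · -- upper: lane A's explicit bound + algebra (as in `fpWeight_relative_bounds`, which needs no support-radius hypothesis for this half)
    obtain ⟨-, hhi⟩ := fpWeight_explicit_bounds L hL hs p hpI hM0 hεT hT hC hpT hpC hp40 hslice hU hr0 hrR hR1 hR1T hcore hsupp hθ
    exact fpWeight_upper_algebra hA0 hX0 he0 hη0 hη2 hηd (Real.exp_pos _).le hG0 hx hx2 hhi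

end Summit.QuantumFields.YangMills.Theorems.FemtoTransferGap.TwoLattice.ConstTube

end
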